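import Mathlib
import Literature.NumberTheory.LFunctions.Zhang2022.DetectorTemplate
import Literature.NumberTheory.LFunctions.Zhang2022.DetectorEndgameValidity
import HarnessLib

/-!
# Zhang (2022), programme F-S3 (cell landau-siegel, family B-det): the detector CLASS `DET` and the
# statement slot of the model barrier det-E5 (`E-det-model`)

Y. Zhang, *Discrete mean estimates and the Landau–Siegel zero*, arXiv:2211.02515v1
[Zhang2022LandauSiegel] — an unrefereed manuscript under adjudication. **WHAT THIS IS NOT: not a
claim about Theorems 1–2 of arXiv:2211.02515, about Landau–Siegel zeros, or about Parity; nothing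
here asserts any claim of the manuscript, and nothing here asserts the model barrier.** «The
programme SEARCHES and TYPES; no claim about Landau–Siegel zeros, Theorems 1–2 of arXiv:2211.02515
or a repaired Margin232 until a kernel theorem says so.»

This file is row **det-E5** of `B-det/EDLIST.md` v1 (planner ls-Bdet-plan, `B-det/PLAN.md` v1 §1
(P1)–(P3), §4), LAYER 1 (the part that does not wait on ls-theory's closed form (c1)):

* `Det.Sampling`, `Det.Family` — the sampling sets `Σ₁ = 𝔷(ψ)` (zeros of `L(s,ψ)` in the window,
  `Skeleton.zeroSet`, (2.14)) / `Σ₂` (zeros of `L(s,ψ)L(s,ψχ)` in `Ω`, `Skeleton.prodZeroSetOmega`,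
  Prop. 2.2) and the families `Ψ₁` (`Skeleton.PsiOne`, §3) / `Ψ` (all primitive `ψ mod p`, `p ∼ P`).
* `Det.DETDesign k` — **class DET of PLAN §4 as data** (class DET = `k ≤ 3`): `k` shifts `β_j = i b_j α(1 + e_j c′α𝓛)`
  with `b_j ∈ (0,5)` (`DetTemplate.ShiftData`), weight polynomials `P₀, P₁` of total degree `≤ 3` in the
  shifted `M`-values `M(ρ+β_j,ψ)` (`Skeleton.Mfun`) — the weight is AFFINE in `1/M′(ρ,ψ)` (v1.1: both
  `m′ = 0` and `m′ = 1` parts, referee Q1 2026-08-26T19:05:05Z) —, a constant phase `c₀`, a sampling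
  set, a family, and an amplifier `a(ψ) ≥ 0`; its weight
  `w_d(ρ,ψ) = c₀·a(ψ)·(P₀(M(ρ+β_•,ψ)) + P₁(M(ρ+β_•,ψ))/M′(ρ,ψ))·ω(ρ)` (`DETDesign.weight`) and its
  skeleton detector `DETDesign.detector d c′ : DetTemplate.Detector`. The test side of a DET design is a pair of
  coefficient sequences admissible in the sense (7.2) (`Skeleton.Adm72`: lengths `< P/T²`, `ℓ = 1`),
  entering through `Detector.pairMean` (support `≤ 2`: ONE sesquilinear statistic per sample).
* `Det.zhangDesign` — the manuscript's detector as a DET design (`k = 3`, `b = (1,2,3)`,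
  `e = (−5,1,−1)`, `P₀ = 0`, `P₁ = X₀X₁X₂`, `c₀ = −i`, `Σ₁`, `Ψ₁`, `a ≡ 1`), with
  `zhangDesign.detector c′ = DetTemplate.zhang c′` PROVED (`detector_zhangDesign`).
* `DetTemplate.Detector.MainEval Δ M E` — the COMBINED evaluation node (Lemma 8.1 ∘ Prop 7.1 shape):
  under (A), for (7.2)-admissible coefficients, `ΣΣ w A(𝐚₁;ρ)Ā(𝐚₂;1−ρ) = M(𝐚₁,𝐚₂)·𝔓 + O(E) + o(𝔓)`
  with a NAMED main-term functional `M : MainTerm` and error functional `E : ErrorTerm`.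
* `Det.FenceModel` — the type of a fence-expectation functional `d ↦ (c′ ↦ M_d)`; and
  **`Det.ModelBarrier fence err`** — det-E5's first half AS A PREDICATE ON THE FUNCTIONAL: «for
  every `d ∈ DET` and every `c′`, the (A)-main term of `d`'s mean IS `fence d c′`». The functional is a
  PARAMETER here and `c′` ranges over `c′ > 0`; LAYER 2 (after ls-theory (c1)) defines the explicit `κ = ½` fence expectation
  (lattice zeros `½ + i(2πt₀ + mα)`, (A)-AFE model values, `ψ`-orthogonality) and instantiates it.
  The second half of det-E5 («fence expectations satisfy every universally valid inequality») is,
  for Cauchy–Schwarz-type endgames, the in-tree theorem `Det.norm_sq_discreteForm_le` applied to the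
  model configuration once LAYER 2 exhibits the fence value as a non-negatively weighted configuration
  sum; for sign-indefinite recipes it is a per-design computation (PLAN §3 D2), not a general claim,
  and nothing of it is typed as a fact here.

* v1.2: FORM A of the family word in kernel shape — `Det.FenceModel.IsConfig fence k d c′` (the
  fence value is the discrete form of ONE non-negatively weighted configuration with test values
  depending only on the coefficient sequence), `Det.fenceGram`, and the theorem schema
  **`FenceModel.IsConfig.endgame_nonneg`** / `not_closing`: configurationality ⇒ every
  configuration-valid endgame (`Det.ConfigValid`, file `DetectorEndgameValidity.lean`) is `≥ 0` on
  the design's main-term Gram array at every stage — so the word «KILL(B-det) inside DET» is exactly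
  `ModelBarrier fenceMain fenceErr ∧ ∀ admissible d, fenceMain.IsConfig d` (both about the explicit
  LAYER-2 functional) plus the per-cell model values for sign-indefinite members.

0 named facts, 0 sorries: every `def … : Prop` below has explicit parameters (a predicate ON a
design / functional), stated, never asserted (OBJECTIVE.md §1.5 of the cell).

## References

* Y. Zhang, arXiv:2211.02515v1 (2022), §2 (2.13)–(2.17), Lemma 2.3, Prop. 2.2; §7 (7.1)–(7.2),
  Prop. 7.1; §8 Lemma 8.1. [cite: Zhang2022LandauSiegel, §§2, 7, 8]
* Cell documents (not literature): `B-det/PLAN.md` v1 §1, §4; `B-det/EDLIST.md` v1 row det-E5;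
  `theory/LEVERS.md` v2.2 §0.6 (B1)–(B4).
-/

open Complex Real ComplexConjugate

noncomputable section

namespace Literature.NumberTheory.LFunctions.Zhang2022.DetTemplate

open Skeleton

/-- **The combined evaluation node** (Lemma 8.1 ∘ Proposition 7.1 shape): under (A), for all large
`D`, for `𝐚₁, 𝐚₂` admissible in the sense (7.2) with bound `B`,
`|ΣΣ w(ρ,ψ)A(𝐚₁;ρ,ψ)Ā(𝐚₂;1−ρ,ψ) − M(𝐚₁,𝐚₂)·𝔓| ≤ C·E(𝐚₁,𝐚₂) + ε𝔓` with a NAMED main-term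
functional `M` and error functional `E`. For the manuscript's detector this is the conjunction of the
Lemma 8.1 and Prop. 7.1 nodes with `M = zhangMain + reflected`. A predicate ON the design — stated,
never asserted. [cite: Zhang2022LandauSiegel, §7 Prop. 7.1, §8 Lemma 8.1] -/
def Detector.MainEval (Δ : Detector) (M : MainTerm) (E : ErrorTerm) : Prop :=
  ∀ B : ℝ, ∀ ε : ℝ, 0 < ε → ∃ C : ℝ, ForAllLarge fun D _ χ => AssumptionA D χ →
    ∀ a₁ a₂ : ℕ → ℂ, Adm72 D B a₁ → Adm72 D B a₂ →
      ‖Δ.pairMean χ a₁ a₂ - M D χ a₁ a₂ * frakP D‖ ≤ C * E D χ a₁ a₂ + ε * frakP D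

end Literature.NumberTheory.LFunctions.Zhang2022.DetTemplate

namespace Literature.NumberTheory.LFunctions.Zhang2022.Det

open Skeleton DetTemplate

/-! ## Class DET (PLAN §4) as data -/

/-- The two sampling sets of class DET: `Σ₁ = 𝔷(ψ)` (2.14) and `Σ₂ =` the zeros of
`L(s,ψ)L(s,ψχ)` in `Ω` (Prop. 2.2). [cite: Zhang2022LandauSiegel, §2 (2.14), Prop. 2.2] -/
inductive Sampling
  /-- `Σ₁ = 𝔷(ψ)`: zeros of `L(s,ψ)` in the window (2.14) (`Skeleton.zeroSet`) -/
  | zerosL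
  /-- `Σ₂`: zeros of `L(s,ψ)L(s,ψχ)` in `Ω` (`Skeleton.prodZeroSetOmega`) -/
  | zerosProd

/-- The two families of class DET: `Ψ₁` (§3 p. 7) and `Ψ` (all primitive `ψ mod p`, `p ∼ P`).
[cite: Zhang2022LandauSiegel, §2 p. 4, §3 p. 7] -/
inductive Family
  /-- `Ψ₁` (`Skeleton.PsiOne`) -/
  | psiOne
  /-- `Ψ` (every `ψ` of the skeleton's type `Chr D`) -/
  | psiAll

/-- The sampled set of points of a sampling choice. [cite: Zhang2022LandauSiegel, §2 (2.14), Prop. 2.2] -/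
def Sampling.pts : Sampling → (D : ℕ) → [NeZero D] → DirichletCharacter ℂ D → Chr D → Set ℂ
  | .zerosL => fun D _ _ x => zeroSet D x
  | .zerosProd => fun _ _ χ x => prodZeroSetOmega χ x

/-- The set of characters of a family choice. [cite: Zhang2022LandauSiegel, §3 p. 7] -/
def Family.fam : Family → (D : ℕ) → [NeZero D] → DirichletCharacter ℂ D → Set (Chr D)
  | .psiOne => fun _ _ χ => PsiOne χ
  | .psiAll => fun _ _ _ => Set.univ

/-- **A design of class DET with `k` shifts** (`B-det/PLAN.md` v1 §4; class DET is `k ≤ 3`):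
shifts `β_j = i b_j α(1+e_j c′α𝓛)` with `b_j ∈ (0,5)`; a weight AFFINE in `1/M′(ρ,ψ)` with polynomial
coefficients `P₀, P₁` of total degree `≤ 3` in the shifted `M`-values (v1.1, on the referee's Q1
2026-08-26T19:05:05Z: both `m′ = 0` and `m′ = 1` parts at once, so two-sided/"W4"-type weights
`P₀(M) + P₁(M)/M′` are inside the class); a constant phase `c₀`; a sampling set; a family; an
amplifier `a(ψ) ≥ 0`. Sign-indefinite weights are allowed (no admissibility of `b` is required). The
manuscript's detector is `zhangDesign : DETDesign 3` (`P₀ = 0`, `P₁ = X₀X₁X₂`).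
[cite: Zhang2022LandauSiegel, §2 (2.13)–(2.16), Lemma 2.3] -/
structure DETDesign (k : ℕ) where
  /-- the shift data `(b_j, e_j)` -/
  shift : ShiftData k
  /-- `b_j ∈ (0, 5)` -/
  b_mem : ∀ j, 0 < shift.b j ∧ shift.b j < 5
  /-- the weight polynomial WITHOUT the `1/M′(ρ,ψ)` factor, in the shifted `M`-values `X_j ↦ M(ρ+β_j,ψ)` -/
  P0 : MvPolynomial (Fin k) ℂ
  /-- of total degree `≤ 3` -/
  deg0_le : P0.totalDegree ≤ 3
  /-- the weight polynomial carrying the factor `1/M′(ρ,ψ)` (printed: `X₀X₁X₂`) -/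
  P1 : MvPolynomial (Fin k) ℂ
  /-- of total degree `≤ 3` -/
  deg1_le : P1.totalDegree ≤ 3
  /-- the constant phase (printed `−i`) -/
  c0 : ℂ
  /-- the sampling set -/
  sampling : Sampling
  /-- the family -/
  family : Family
  /-- the amplifier `a(ψ)` -/
  amp : (D : ℕ) → [NeZero D] → DirichletCharacter ℂ D → Chr D → ℝ
  /-- `a(ψ) ≥ 0` -/
  amp_nonneg : ∀ (D : ℕ) [NeZero D] (χ : DirichletCharacter ℂ D) (x : Chr D), 0 ≤ amp D χ x

namespace DETDesign

variable {k : ℕ} (d : DETDesign k) (c' : ℝ)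

/-- **The weight of a DET design**:
`w_d(ρ,ψ) = c₀·a(ψ)·(P₀(M(ρ+β_•,ψ)) + P₁(M(ρ+β_•,ψ))/M′(ρ,ψ))·ω(ρ)`.
[cite: Zhang2022LandauSiegel, §2 p. 5, (2.15)] -/
def weight (D : ℕ) [NeZero D] (χ : DirichletCharacter ℂ D) (x : Chr D) (ρ : ℂ) : ℂ :=
  d.c0 * (d.amp D χ x : ℂ) *
      (MvPolynomial.eval (fun j => Mfun x.ψ (ρ + d.shift.beta c' D j)) d.P0 +
        MvPolynomial.eval (fun j => Mfun x.ψ (ρ + d.shift.beta c' D j)) d.P1 /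
          deriv (Mfun x.ψ) ρ) * omegaW D ρ

/-- **The skeleton detector of a DET design.** [cite: Zhang2022LandauSiegel, §2 (2.14)–(2.16)] -/
def detector : Detector where
  fam := d.family.fam
  pts := d.sampling.pts
  wt := fun D _ χ x ρ => d.weight c' D χ x ρ

end DETDesign

/-- The weight polynomial `X₀X₁X₂` of the manuscript's detector. [cite: Zhang2022LandauSiegel, §2 p. 5] -/
def zhangPoly : MvPolynomial (Fin 3) ℂ := ∏ j, MvPolynomial.X j

/-- `X₀X₁X₂` has total degree `≤ 3`. [folklore] -/
private theorem totalDegree_zhangPoly_le : zhangPoly.totalDegree ≤ 3 := by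
  unfold zhangPoly
  refine (MvPolynomial.totalDegree_finsetProd _ _).trans ?_
  simp [MvPolynomial.totalDegree_X]

/-- `b = (1,2,3)` lies in `(0,5)³`. [folklore] -/
private theorem zhangShift_b_mem (j : Fin 3) : 0 < zhangShift.b j ∧ zhangShift.b j < 5 := by
  fin_cases j <;> simp [zhangShift] <;> norm_num

/-- `0` has total degree `≤ 3`. [folklore] -/
private theorem totalDegree_zero_le_three {k : ℕ} : (0 : MvPolynomial (Fin k) ℂ).totalDegree ≤ 3 := by
  simp

/-- **The manuscript's detector as a DET design**: `k = 3`, `(b, e) = zhangShift`, `P₀ = 0`,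
`P₁ = X₀X₁X₂`, `c₀ = −i`, sampling `Σ₁`, family `Ψ₁`, amplifier `1`.
[cite: Zhang2022LandauSiegel, §2 (2.13)–(2.16)] -/
def zhangDesign : DETDesign 3 where
  shift := zhangShift
  b_mem := zhangShift_b_mem
  P0 := 0
  deg0_le := totalDegree_zero_le_three
  P1 := zhangPoly
  deg1_le := totalDegree_zhangPoly_le
  c0 := -I
  sampling := .zerosL
  family := .psiOne
  amp := fun _ _ _ _ => 1
  amp_nonneg := fun _ _ _ _ => zero_le_one

/-- The weight of `zhangDesign` is `𝔠*(ρ,ψ)ω(ρ)`. [cite: Zhang2022LandauSiegel, §2 p. 5, (2.15)] -/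
theorem weight_zhangDesign (c' : ℝ) (D : ℕ) [NeZero D] (χ : DirichletCharacter ℂ D) (x : Chr D)
    (ρ : ℂ) : zhangDesign.weight c' D χ x ρ = cstar c' D x ρ * omegaW D ρ := by
  have hev : MvPolynomial.eval (fun j => Mfun x.ψ (ρ + zhangShift.beta c' D j)) zhangPoly =
      ∏ j, Mfun x.ψ (ρ + zhangShift.beta c' D j) := by
    unfold zhangPoly
    rw [map_prod]
    simp only [MvPolynomial.eval_X]
  rw [← cstarS_zhang]
  simp only [DETDesign.weight, zhangDesign, map_zero, zero_add, Complex.ofReal_one, mul_one, cstarS,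
    hev]
  ring

/-- **`zhangDesign.detector c′ = DetTemplate.zhang c′`.** [cite: Zhang2022LandauSiegel, §2 (2.14)–(2.16)] -/
theorem detector_zhangDesign (c' : ℝ) : zhangDesign.detector c' = zhang c' := by
  unfold DETDesign.detector zhang
  congr 1
  funext D _ χ x ρ
  exact weight_zhangDesign c' D χ x ρ

/-! ## det-E5, first half, as a predicate on the fence functional -/

/-- **A fence-expectation functional**: to each DET design (any `k`) and each `c′` a main-term functional
`M_d : MainTerm` (the slot LAYER 2 fills with the explicit `κ = ½` one-configuration expectation).
[cite: Zhang2022LandauSiegel, §7 Prop. 7.1] -/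
abbrev FenceModel := (k : ℕ) → DETDesign k → ℝ → MainTerm

/-- **An error-functional assignment** `d ↦ (c′ ↦ E_d)`. [cite: Zhang2022LandauSiegel, §7 Prop. 7.1] -/
abbrev FenceError := (k : ℕ) → DETDesign k → ℝ → ErrorTerm

/-- **det-E5 (`E-det-model`), first half, ON a fence functional**: for every `c′ > 0` (the constant of
Prop. 2.2 (iii); v1.1 restricts to the meaningful range on the referee's Q2), every `k ≤ 3` and every
design `d` of class DET with `k` shifts, under (A) the discrete mean of `d` against any (7.2)-admissible coefficient pair
evaluates to `fence d c′ (𝐚₁,𝐚₂)·𝔓 + O(err d c′ (𝐚₁,𝐚₂)) + o(𝔓)` (`Detector.MainEval`). A predicate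
ON the functional — stated, never asserted; the cell's claim «m_d = E_fence[d]» (PLAN §1 (P1)) is
`ModelBarrier fenceMain fenceErr` for the explicit LAYER-2 functional.
[cite: Zhang2022LandauSiegel, §7 Prop. 7.1, §8 Lemma 8.1] -/
def ModelBarrier (fence : FenceModel) (err : FenceError) : Prop :=
  ∀ c' : ℝ, 0 < c' → ∀ k : ℕ, k ≤ 3 → ∀ d : DETDesign k,
    (d.detector c').MainEval (fence k d c') (err k d c')

/-- `ModelBarrier` specialises to the manuscript's detector: it contains the statement that
`DetTemplate.zhang c′` evaluates with main term `fence zhangDesign c′`.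
[cite: Zhang2022LandauSiegel, §7 Prop. 7.1, §8 Lemma 8.1] -/
theorem ModelBarrier.zhang {fence : FenceModel} {err : FenceError} (h : ModelBarrier fence err)
    {c' : ℝ} (hc : 0 < c') :
    (DetTemplate.zhang c').MainEval (fence 3 zhangDesign c') (err 3 zhangDesign c') := by
  rw [← detector_zhangDesign]
  exact h c' hc 3 le_rfl zhangDesign

/-! ## v1.2 · FORM A of the family word in kernel shape: faithfulness ∧ configurationality ⇒ no valid endgame closes -/

/-- **A fence functional is CONFIGURATIONAL on design `d` at `c′`** iff at every stage `(D, χ)` its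
value on any pair of coefficient sequences is the discrete form `Ξ_w(u_{𝐚₁}, u_{𝐚₂})` of ONE finite
NON-NEGATIVELY weighted configuration whose test values `u_𝐚` depend only on the coefficient
sequence `𝐚` (the `κ = ½` fence: lattice zeros, model weights `≥ 0` for admissible `S`, model
character average — LAYER 2 proves this for the explicit functional; for sign-indefinite `S` it is
false and nothing is claimed). A predicate ON the functional — stated, never asserted.
[cite: Zhang2022LandauSiegel, §2 (2.16)–(2.17)] -/
def FenceModel.IsConfig (fence : FenceModel) (k : ℕ) (d : DETDesign k) (c' : ℝ) : Prop :=
  ∀ (D : ℕ) [NeZero D] (χ : DirichletCharacter ℂ D),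
    ∃ (n : ℕ) (w : Fin n → ℝ) (ev : (ℕ → ℂ) → Fin n → ℂ),
      (∀ i, 0 ≤ w i) ∧ ∀ a₁ a₂ : ℕ → ℂ, fence k d c' D χ a₁ a₂ = discreteForm Finset.univ w (ev a₁) (ev a₂)

/-- **The main-term Gram array of a design** on `r` coefficient sequences under a fence functional:
`(p,q) ↦ fence(d)(𝐚_p, 𝐚_q)` at stage `(D, χ)`. [cite: Zhang2022LandauSiegel, §2 (2.16)–(2.17)] -/
def fenceGram (fence : FenceModel) {k : ℕ} (d : DETDesign k) (c' : ℝ) (D : ℕ) [NeZero D]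
    (χ : DirichletCharacter ℂ D) {r : ℕ} (a : Fin r → ℕ → ℂ) : GramData r :=
  fun p q => fence k d c' D χ (a p) (a q)

/-- **FORM A, endgame clause, as a theorem schema**: if the fence functional is configurational on
`d`, then EVERY configuration-valid endgame objective is `≥ 0` on `d`'s main-term Gram array at every
stage and for every family of coefficient sequences — the main terms of a DET design under a
configurational fence can never satisfy a valid-inequality closing condition (the content of
«(E_fence[d])_d satisfies every universally valid inequality», B-det/PLAN §1 (P1), EDLIST det-E5
part (2)). Together with `ModelBarrier` (faithfulness) this is the family word's FORM A.
[cite: Zhang2022LandauSiegel, §2 (2.16)–(2.19), Props 2.4–2.6 p. 6] -/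
theorem FenceModel.IsConfig.endgame_nonneg {fence : FenceModel} {k : ℕ} {d : DETDesign k} {c' : ℝ}
    (h : fence.IsConfig k d c') {r : ℕ} {Φ : GramData r → ℝ} (hΦ : ConfigValid Φ) (D : ℕ) [NeZero D]
    (χ : DirichletCharacter ℂ D) (a : Fin r → ℕ → ℂ) : 0 ≤ Φ (fenceGram fence d c' D χ a) := by
  obtain ⟨n, w, ev, hw, hval⟩ := h D χ
  have hG : fenceGram fence d c' D χ a = configGram Finset.univ w (fun p => ev (a p)) := by
    funext p q
    exact hval (a p) (a q)
  rw [hG]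
  exact hΦ Finset.univ w (fun i _ => hw i) _

/-- FORM A, endgame clause, contrapositive: under a configurational fence no configuration-valid
endgame's closing condition `Φ < 0` holds on the main terms.
[cite: Zhang2022LandauSiegel, §2 (2.16)–(2.19), Props 2.4–2.6 p. 6] -/
theorem FenceModel.IsConfig.not_closing {fence : FenceModel} {k : ℕ} {d : DETDesign k} {c' : ℝ}
    (h : fence.IsConfig k d c') {r : ℕ} {Φ : GramData r → ℝ} (hΦ : ConfigValid Φ) (D : ℕ) [NeZero D]
    (χ : DirichletCharacter ℂ D) (a : Fin r → ℕ → ℂ) : ¬ Φ (fenceGram fence d c' D χ a) < 0 :=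
  not_lt.mpr (h.endgame_nonneg hΦ D χ a)

end Literature.NumberTheory.LFunctions.Zhang2022.Det

end
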